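import Summits.AnomalousDissipation.AnomalousDissipation.Theorems.MomentParityQuarticGateFourierDictionary
import Summits.AnomalousDissipation.AnomalousDissipation.Theorems.MomentParityQuarticGateDesignSymShift

/-!
# Fourier dictionary for the axial Casimir stubs (line `axis-sectors` of crux `MomentParity.QuarticGate`), part 2

Continuation of `MomentParityQuarticGateFourierDictionary.lean` (D1–D3 there). Here:

* (D4) TRANSLATES. For `a : T³`: `𝓕(g(· + a))(k) = e_k(a) ĝ(k)` (`tcoef_shifted`; translates of band
  tests are band tests and the torus calculus commutes with translations —
  `isBandTest_comp_add_right`, `fderiv/laplacian_comp_add_right` of `…DesignSymShift`, reused here);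
  every level-`N` field `u` has a level-`N` TRANSLATE `u' = τ_a u = u(· - a)`, characterised by
  `coef u' k = e_k(-a) • coef u k` (`exists_isLevel_coef_eq_twist`), and for any such pair:
  `(u, g(·+a)) = (u', g)` (`pairing_shifted`), `∫ (u⊗u) : ∇(g(·+a)) = ∫ (u'⊗u') : ∇g`
  (`inertialPairing_shifted`), `⟨F(u), g(·+a)⟩ = ⟨F(u'), g⟩` for a force with `f(·+a) = f`
  (`nsGeneratorPairing_shifted`), `∇p_a(u) = (∇p(u'))(·+a)` for the observable `p_a` with translated
  tests (`polyGrad_shifted`), hence `{p_a, F}(u) = {p, F}(u')` (`nsGeneratorPairing_polyGrad_shifted`),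
  `p_a(u) = p(u')` (`eval_pairing_shifted`), `‖u'‖ = ‖u‖` (`norm_eq_of_coef_twist`); level-`N` fields are
  determined by their coefficients (`eq_of_coef_eq`).

Multilinear extraction (D6), the shear grid `H_L` with its character sums (D7) and finite Fourier
uniqueness in one variable (D5) are in part 3 (independent of parts 1–2).
-/

namespace Summit.AnomalousDissipation.AnomalousDissipation.Theorems.MomentParityQuarticGate

open MeasureTheory Filter
open scoped InnerProductSpace RealInnerProductSpace ComplexConjugate ENNReal
open Literature.Analysis.FunctionSpaces Literature.Analysis.FluidPDE
open Summit.AnomalousDissipation.AnomalousDissipation.Theses.MomentParity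
open Summit.AnomalousDissipation.AnomalousDissipation.Theorems.QuarticGate.Negative

-- `Summit.<Summit>.<Problem>` is the tree's mandated summit-side namespace (CONVENTIONS §2); for this
-- single-conjunct summit the two coincide, so the duplicate is deliberate.
set_option linter.dupNamespace false

noncomputable section

/-! ## D4 — translates -/

section TranslateCalculus

/-- **Fourier coefficients of a translated test**, `tcoef` form of
`mFourierCoeff_complexify_comp_add_right` (`…DesignSymShift`): `𝓕(g(· + a))(k) = e_k(a) • ĝ(k)`.
Translates of band tests are band tests: `isBandTest_comp_add_right` (`…DesignSymShift`); the torus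
calculus commutes with translations: `fderiv/partialDeriv/divergence/laplacian_comp_add_right` there. [folklore] -/
theorem tcoef_shifted (g : UnitAddTorus (Fin 3) → EuclideanSpace ℝ (Fin 3))
    (a : UnitAddTorus (Fin 3)) (k : Fin 3 → ℤ) :
    tcoef (fun x => g (x + a)) k = (UnitAddTorus.mFourier k a : ℂ) • tcoef g k :=
  mFourierCoeff_complexify_comp_add_right g a k

/-- `|e_k(x)| = 1`. [folklore] -/
theorem norm_mFourier_apply_eq_one (k : Fin 3 → ℤ) (x : UnitAddTorus (Fin 3)) :
    ‖(UnitAddTorus.mFourier k x : ℂ)‖ = 1 := by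
  simp only [UnitAddTorus.mFourier, fourier_apply, ContinuousMap.coe_mk, norm_prod, Circle.norm_coe,
    Finset.prod_const_one]

/-- **Translate of a real trigonometric polynomial** = twist of its coefficients by the characters:
`realTrigPoly S (k ↦ e_k(-a) • c k) (x) = realTrigPoly S c (x - a)`. [folklore] -/
theorem realTrigPoly_twist (S : Finset (Fin 3 → ℤ)) (c : (Fin 3 → ℤ) → EuclideanSpace ℂ (Fin 3))
    (a x : UnitAddTorus (Fin 3)) :
    Torus.realTrigPoly S (fun k => (UnitAddTorus.mFourier k (-a) : ℂ) • c k) x =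
      Torus.realTrigPoly S c (x - a) := by
  simp only [Torus.realTrigPoly_apply, Torus.trigPoly_apply]
  congr 1
  refine Finset.sum_congr rfl fun k _ => ?_
  rw [sub_eq_add_neg, Torus.mFourier_apply_add, smul_smul]

/-- The twisted family is conjugate symmetric. [folklore] -/
theorem isConjSymm_twist {c : (Fin 3 → ℤ) → EuclideanSpace ℂ (Fin 3)} (hc : Torus.IsConjSymm c)
    (a : UnitAddTorus (Fin 3)) :
    Torus.IsConjSymm (fun k => (UnitAddTorus.mFourier k (-a) : ℂ) • c k) := by
  intro k
  dsimp only
  rw [hc k, EuclideanSpace.conjVec_smul, UnitAddTorus.mFourier_neg]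

/-- The twisted family is transversal where the original one is. [folklore] -/
theorem isTransversal_twist {S : Finset (Fin 3 → ℤ)} {c : (Fin 3 → ℤ) → EuclideanSpace ℂ (Fin 3)}
    (hT : Torus.IsTransversal S c) (a : UnitAddTorus (Fin 3)) :
    Torus.IsTransversal S (fun k => (UnitAddTorus.mFourier k (-a) : ℂ) • c k) := by
  intro k hk
  have h := hT k hk
  simp only [PiLp.smul_apply, smul_eq_mul]
  calc ∑ j, (k j : ℂ) * ((UnitAddTorus.mFourier k (-a) : ℂ) * c k j)
      = (UnitAddTorus.mFourier k (-a) : ℂ) * ∑ j, (k j : ℂ) * c k j := by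
        rw [Finset.mul_sum]
        exact Finset.sum_congr rfl fun j _ => by ring
    _ = 0 := by rw [h, mul_zero]

end TranslateCalculus

section Translate

variable {N : ℕ} {u u' : Torus.energySpace (Fin 3)} {a : UnitAddTorus (Fin 3)}

/-- **D4 — existence of the translate.** For a level-`N` field `u` and `a : T³` there is a level-`N`
field `u'` (the translate `τ_a u = u(· - a)`) with `coef u' k = e_k(-a) • coef u k`. [folklore] -/
theorem exists_isLevel_coef_eq_twist (hu : IsLevel N u) (a : UnitAddTorus (Fin 3)) :
    ∃ u' : Torus.energySpace (Fin 3), IsLevel N u' ∧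
      ∀ k, coef u' k = (UnitAddTorus.mFourier k (-a) : ℂ) • coef u k := by
  obtain ⟨u', hu', hcoef, -⟩ := exists_isLevel_coef_eq N (fun k => (UnitAddTorus.mFourier k (-a) : ℂ) • coef u k)
    (isConjSymm_twist (isConjSymm_coef u) a) (isTransversal_twist (isTransversal_coef u _) a)
    (fun k hk => show (UnitAddTorus.mFourier k (-a) : ℂ) • coef u k = 0 by
      rw [coef_eq_zero_of_not_mem hu hk, smul_zero])
  exact ⟨u', hu', hcoef⟩

/-- **Level-`N` fields are determined by their coefficients.** [folklore] -/
theorem eq_of_coef_eq (hu : IsLevel N u) (hu' : IsLevel N u') (h : ∀ k, coef u' k = coef u k) : u' = u := by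
  have h1 := coe_ae_eq_realTrigPoly_coef hu
  have h2 := coe_ae_eq_realTrigPoly_coef hu'
  rw [show coef u' = coef u from funext h] at h2
  exact Subtype.ext (Lp.ext (h2.trans h1.symm))

/-- The translate is represented by the translated trigonometric polynomial:
`u' = realTrigPoly S* (coef u) (· - a)` a.e. [folklore] -/
theorem coe_ae_eq_of_coef_twist (hu' : IsLevel N u')
    (h : ∀ k, coef u' k = (UnitAddTorus.mFourier k (-a) : ℂ) • coef u k) :
    (u'.1 : UnitAddTorus (Fin 3) → EuclideanSpace ℝ (Fin 3)) =ᵐ[volume]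
      fun x => Torus.realTrigPoly ((Torus.freqBall N).erase 0) (coef u) (x - a) := by
  refine (coe_ae_eq_realTrigPoly_coef hu').trans (ae_of_all _ fun x => ?_)
  rw [show coef u' = fun k => (UnitAddTorus.mFourier k (-a) : ℂ) • coef u k from funext h]
  exact realTrigPoly_twist _ _ a x

/-- **D4 — pairings of the translate**: `(u, g(· + a)) = (τ_a u, g)` for EVERY `g : T³ → ℝ³`
(change of variables `x ↦ x + a`). [folklore] -/
theorem pairing_shifted (hu : IsLevel N u) (hu' : IsLevel N u')
    (h : ∀ k, coef u' k = (UnitAddTorus.mFourier k (-a) : ℂ) • coef u k)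
    (g : UnitAddTorus (Fin 3) → EuclideanSpace ℝ (Fin 3)) :
    Torus.pairing u.1 (fun x => g (x + a)) = Torus.pairing u'.1 g := by
  set p := Torus.realTrigPoly ((Torus.freqBall N).erase 0) (coef u) with hp
  have h1 := coe_ae_eq_realTrigPoly_coef hu
  have h2 := coe_ae_eq_of_coef_twist hu' h
  unfold Torus.pairing
  rw [integral_congr_ae (h1.mono fun x hx => by simp only [hx, hp] :
      (fun x => ⟪(u.1 : UnitAddTorus (Fin 3) → EuclideanSpace ℝ (Fin 3)) x, g (x + a)⟫_ℝ) =ᵐ[volume]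
        fun x => ⟪p x, g (x + a)⟫_ℝ),
    integral_congr_ae (h2.mono fun x hx => by simp only [hx, hp] :
      (fun x => ⟪(u'.1 : UnitAddTorus (Fin 3) → EuclideanSpace ℝ (Fin 3)) x, g x⟫_ℝ) =ᵐ[volume]
        fun x => ⟪p (x - a), g x⟫_ℝ)]
  rw [← integral_add_right_eq_self (fun x => ⟪p (x - a), g x⟫_ℝ) a]
  simp only [add_sub_cancel_right]

/-- **D4 — the observable of translated tests is the observable at the translate**:
`P((u, gⱼ(· + a))ⱼ) = P((τ_a u, gⱼ)ⱼ)`. [folklore] -/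
theorem eval_pairing_shifted (hu : IsLevel N u) (hu' : IsLevel N u')
    (h : ∀ k, coef u' k = (UnitAddTorus.mFourier k (-a) : ℂ) • coef u k) {m : ℕ}
    (g : Fin m → UnitAddTorus (Fin 3) → EuclideanSpace ℝ (Fin 3)) (P : MvPolynomial (Fin m) ℝ) :
    MvPolynomial.eval (fun j => Torus.pairing u.1 (fun x => g j (x + a))) P =
      MvPolynomial.eval (fun j => Torus.pairing u'.1 (g j)) P := by
  rw [show (fun j => Torus.pairing u.1 (fun x => g j (x + a))) = fun j => Torus.pairing u'.1 (g j) from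
    funext fun j => pairing_shifted hu hu' h (g j)]

/-- **D4 — inertial pairing of the translate**: `∫ (u ⊗ u) : ∇(g(· + a)) = ∫ (τ_a u ⊗ τ_a u) : ∇g`
for EVERY `g`. [folklore] -/
theorem inertialPairing_shifted (hu : IsLevel N u) (hu' : IsLevel N u')
    (h : ∀ k, coef u' k = (UnitAddTorus.mFourier k (-a) : ℂ) • coef u k)
    (g : UnitAddTorus (Fin 3) → EuclideanSpace ℝ (Fin 3)) :
    Torus.inertialPairing u.1 (fun x => g (x + a)) = Torus.inertialPairing u'.1 g := by
  set p := Torus.realTrigPoly ((Torus.freqBall N).erase 0) (coef u) with hp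
  have h1 := coe_ae_eq_realTrigPoly_coef hu
  have h2 := coe_ae_eq_of_coef_twist hu' h
  unfold Torus.inertialPairing
  rw [integral_congr_ae (h1.mono fun x hx => by simp only [hx, hp, fderiv_comp_add_right] :
      (fun x => ⟪Torus.fderiv (fun y => g (y + a)) x
          ((u.1 : UnitAddTorus (Fin 3) → EuclideanSpace ℝ (Fin 3)) x),
          (u.1 : UnitAddTorus (Fin 3) → EuclideanSpace ℝ (Fin 3)) x⟫_ℝ) =ᵐ[volume]
        fun x => ⟪Torus.fderiv g (x + a) (p x), p x⟫_ℝ),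
    integral_congr_ae (h2.mono fun x hx => by simp only [hx, hp] :
      (fun x => ⟪Torus.fderiv g x ((u'.1 : UnitAddTorus (Fin 3) → EuclideanSpace ℝ (Fin 3)) x),
          (u'.1 : UnitAddTorus (Fin 3) → EuclideanSpace ℝ (Fin 3)) x⟫_ℝ) =ᵐ[volume]
        fun x => ⟪Torus.fderiv g x (p (x - a)), p (x - a)⟫_ℝ)]
  rw [← integral_add_right_eq_self (fun x => ⟪Torus.fderiv g x (p (x - a)), p (x - a)⟫_ℝ) a]
  simp only [add_sub_cancel_right]

/-- **D4 — the Stokes term of the translate**: `∫ ⟪u, Δ(g(· + a))⟫ = ∫ ⟪τ_a u, Δ g⟫`. [folklore] -/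
theorem integral_inner_laplacian_shifted (hu : IsLevel N u) (hu' : IsLevel N u')
    (h : ∀ k, coef u' k = (UnitAddTorus.mFourier k (-a) : ℂ) • coef u k)
    (g : UnitAddTorus (Fin 3) → EuclideanSpace ℝ (Fin 3)) :
    ∫ x, ⟪(u.1 : UnitAddTorus (Fin 3) → EuclideanSpace ℝ (Fin 3)) x,
        Torus.laplacian (fun y => g (y + a)) x⟫_ℝ =
      ∫ x, ⟪(u'.1 : UnitAddTorus (Fin 3) → EuclideanSpace ℝ (Fin 3)) x, Torus.laplacian g x⟫_ℝ := by
  set p := Torus.realTrigPoly ((Torus.freqBall N).erase 0) (coef u) with hp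
  have h1 := coe_ae_eq_realTrigPoly_coef hu
  have h2 := coe_ae_eq_of_coef_twist hu' h
  rw [integral_congr_ae (h1.mono fun x hx => by simp only [hx, hp, laplacian_comp_add_right] :
      (fun x => ⟪(u.1 : UnitAddTorus (Fin 3) → EuclideanSpace ℝ (Fin 3)) x,
          Torus.laplacian (fun y => g (y + a)) x⟫_ℝ) =ᵐ[volume]
        fun x => ⟪p x, Torus.laplacian g (x + a)⟫_ℝ),
    integral_congr_ae (h2.mono fun x hx => by simp only [hx, hp] :
      (fun x => ⟪(u'.1 : UnitAddTorus (Fin 3) → EuclideanSpace ℝ (Fin 3)) x, Torus.laplacian g x⟫_ℝ)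
        =ᵐ[volume] fun x => ⟪p (x - a), Torus.laplacian g x⟫_ℝ)]
  rw [← integral_add_right_eq_self (fun x => ⟪p (x - a), Torus.laplacian g x⟫_ℝ) a]
  simp only [add_sub_cancel_right]

/-- **D4 — covariance of the generator**: for a force with `f(· + a) = f`,
`⟨F(u), g(· + a)⟩ = ⟨F(τ_a u), g⟩` for every viscosity and every `g`. [folklore] -/
theorem nsGeneratorPairing_shifted (hu : IsLevel N u) (hu' : IsLevel N u')
    (h : ∀ k, coef u' k = (UnitAddTorus.mFourier k (-a) : ℂ) • coef u k) (ν : ℝ)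
    {f : UnitAddTorus (Fin 3) → EuclideanSpace ℝ (Fin 3)} (hf : ∀ x, f (x + a) = f x)
    (g : UnitAddTorus (Fin 3) → EuclideanSpace ℝ (Fin 3)) :
    Torus.nsGeneratorPairing ν f u (fun x => g (x + a)) = Torus.nsGeneratorPairing ν f u' g := by
  unfold Torus.nsGeneratorPairing
  rw [integral_inner_laplacian_shifted hu hu' h, inertialPairing_shifted hu hu' h]
  congr 2
  rw [← integral_add_right_eq_self (fun x => ⟪f x, g x⟫_ℝ) a]
  simp only [hf]

/-- **D4 — the differential field of translated tests**: `∇p_a(u) = (∇p(τ_a u))(· + a)` where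
`p_a` uses the tests `gᵢ(· + a)`. [folklore] -/
theorem polyGrad_shifted (hu : IsLevel N u) (hu' : IsLevel N u')
    (h : ∀ k, coef u' k = (UnitAddTorus.mFourier k (-a) : ℂ) • coef u k) {m : ℕ}
    (g : Fin m → UnitAddTorus (Fin 3) → EuclideanSpace ℝ (Fin 3)) (P : MvPolynomial (Fin m) ℝ) :
    polyGrad (fun i x => g i (x + a)) P u = fun x => polyGrad g P u' (x + a) := by
  funext x
  unfold polyGrad
  rw [show (fun j => Torus.pairing u.1 (fun x => g j (x + a))) = fun j => Torus.pairing u'.1 (g j) from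
    funext fun j => pairing_shifted hu hu' h (g j)]

/-- **D4 — covariance of polynomial rows**: `{p_a, F}(u) = ⟨F(u), ∇p_a(u)⟩ = ⟨F(τ_a u), ∇p(τ_a u)⟩ = {p, F}(τ_a u)`
for a force with `f(· + a) = f` (in particular for the Euler bracket, `ν = 0`, `f = 0`). [folklore] -/
theorem nsGeneratorPairing_polyGrad_shifted (hu : IsLevel N u) (hu' : IsLevel N u')
    (h : ∀ k, coef u' k = (UnitAddTorus.mFourier k (-a) : ℂ) • coef u k) (ν : ℝ)
    {f : UnitAddTorus (Fin 3) → EuclideanSpace ℝ (Fin 3)} (hf : ∀ x, f (x + a) = f x) {m : ℕ}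
    (g : Fin m → UnitAddTorus (Fin 3) → EuclideanSpace ℝ (Fin 3)) (P : MvPolynomial (Fin m) ℝ) :
    Torus.nsGeneratorPairing ν f u (polyGrad (fun i x => g i (x + a)) P u) =
      Torus.nsGeneratorPairing ν f u' (polyGrad g P u') := by
  rw [polyGrad_shifted hu hu' h g P]
  exact nsGeneratorPairing_shifted hu hu' h ν hf (polyGrad g P u')

/-- **D4 — the Euler bracket is translation covariant**: `{p_a, B_N}(u) = {p, B_N}(τ_a u)`. [folklore] -/
theorem euler_bracket_polyGrad_shifted (hu : IsLevel N u) (hu' : IsLevel N u')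
    (h : ∀ k, coef u' k = (UnitAddTorus.mFourier k (-a) : ℂ) • coef u k) {m : ℕ}
    (g : Fin m → UnitAddTorus (Fin 3) → EuclideanSpace ℝ (Fin 3)) (P : MvPolynomial (Fin m) ℝ) :
    Torus.nsGeneratorPairing (d := Fin 3) 0 0 u (polyGrad (fun i x => g i (x + a)) P u) =
      Torus.nsGeneratorPairing (d := Fin 3) 0 0 u' (polyGrad g P u') :=
  nsGeneratorPairing_polyGrad_shifted hu hu' h 0 (fun _ => rfl) g P

/-- **D4 — the translate has the same energy**: `‖τ_a u‖ = ‖u‖`. [folklore] -/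
theorem norm_eq_of_coef_twist (hu : IsLevel N u) (hu' : IsLevel N u')
    (h : ∀ k, coef u' k = (UnitAddTorus.mFourier k (-a) : ℂ) • coef u k) : ‖u'‖ = ‖u‖ := by
  have h1 := norm_sq_of_ae_eq (coe_ae_eq_realTrigPoly_coef hu) (isConjSymm_coef u)
  have h2 := norm_sq_of_ae_eq (coe_ae_eq_realTrigPoly_coef hu') (isConjSymm_coef u')
  have h3 : ‖u'‖ ^ 2 = ‖u‖ ^ 2 := by
    rw [h1, h2]
    refine Finset.sum_congr rfl fun k _ => ?_
    rw [h k, norm_smul, norm_mFourier_apply_eq_one, one_mul]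
  exact (pow_left_inj₀ (norm_nonneg _) (norm_nonneg _) two_ne_zero).1 h3

/-- Translating twice: coefficients of `τ_b τ_a u` are those of `τ_{a+b} u`. [folklore] -/
theorem coef_twist_twist {u'' : Torus.energySpace (Fin 3)} {b : UnitAddTorus (Fin 3)}
    (h : ∀ k, coef u' k = (UnitAddTorus.mFourier k (-a) : ℂ) • coef u k)
    (h' : ∀ k, coef u'' k = (UnitAddTorus.mFourier k (-b) : ℂ) • coef u' k) (k : Fin 3 → ℤ) :
    coef u'' k = (UnitAddTorus.mFourier k (-(a + b)) : ℂ) • coef u k := by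
  rw [h' k, h k, smul_smul, neg_add, Torus.mFourier_apply_add, mul_comm]

/-- Translating by `0` does nothing. [folklore] -/
theorem eq_of_coef_twist_zero (hu : IsLevel N u) (hu' : IsLevel N u')
    (h : ∀ k, coef u' k = (UnitAddTorus.mFourier k (-(0 : UnitAddTorus (Fin 3))) : ℂ) • coef u k) :
    u' = u :=
  eq_of_coef_eq hu hu' fun k => by
    rw [h k, neg_zero]
    have : (UnitAddTorus.mFourier k (0 : UnitAddTorus (Fin 3)) : ℂ) = 1 := by
      have h0 := Torus.mFourier_apply_add k (0 : UnitAddTorus (Fin 3)) 0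
      rw [add_zero] at h0
      have hne : (UnitAddTorus.mFourier k (0 : UnitAddTorus (Fin 3)) : ℂ) ≠ 0 := fun hz => by
        have := norm_mFourier_apply_eq_one k (0 : UnitAddTorus (Fin 3))
        rw [hz, norm_zero] at this
        exact zero_ne_one this
      exact mul_left_cancel₀ hne (by rw [← h0, mul_one])
    rw [this, one_smul]

end Translate

end

/-! ## Registered sub-goal (summary) -/

/-- **Registered sub-goal `fourierDictionary_shifted` (summary of D4)**: every level-`N` field `u` has,
for every `a : T³`, a level-`N` TRANSLATE `u' = τ_a u` — `𝓕(u')(k) = e_k(-a) 𝓕(u)(k)` — with the same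
energy, `(u, g(· + a)) = (u', g)` for every `g`, and, for every viscosity and every force with
`f(· + a) = f`, `⟨F(u), g(· + a)⟩ = ⟨F(u'), g⟩` and `⟨F(u), ∇p_a(u)⟩ = ⟨F(u'), ∇p(u')⟩` for every
polynomial observable (`p_a` = the observable with translated tests). [folklore] -/
theorem fourierDictionary_shifted : ∀ (N : ℕ) (u : Torus.energySpace (Fin 3)) (a : UnitAddTorus (Fin 3)), IsLevel N u → ∃ u' : Torus.energySpace (Fin 3), IsLevel N u' ∧ (∀ k : Fin 3 → ℤ, UnitAddTorus.mFourierCoeff (EuclideanSpace.complexify ∘ (u'.1 : UnitAddTorus (Fin 3) → EuclideanSpace ℝ (Fin 3))) k = (UnitAddTorus.mFourier k (-a) : ℂ) • UnitAddTorus.mFourierCoeff (EuclideanSpace.complexify ∘ (u.1 : UnitAddTorus (Fin 3) → EuclideanSpace ℝ (Fin 3))) k) ∧ ‖u'‖ = ‖u‖ ∧ (∀ g : UnitAddTorus (Fin 3) → EuclideanSpace ℝ (Fin 3), Torus.pairing u.1 (fun x => g (x + a)) = Torus.pairing u'.1 g) ∧ (∀ (ν : ℝ) (f : UnitAddTorus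 (Fin 3) → EuclideanSpace ℝ (Fin 3)), (∀ x, f (x + a) = f x) → ∀ g : UnitAddTorus (Fin 3) → EuclideanSpace ℝ (Fin 3), Torus.nsGeneratorPairing ν f u (fun x => g (x + a)) = Torus.nsGeneratorPairing ν f u' g) ∧ (∀ (ν : ℝ) (f : UnitAddTorus (Fin 3) → EuclideanSpace ℝ (Fin 3)), (∀ x, f (x + a) = f x) → ∀ (m : ℕ) (g : Fin m → UnitAddTorus (Fin 3) → EuclideanSpace ℝ (Fin 3)) (P : MvPolynomial (Fin m) ℝ), Torus.nsGeneratorPairing ν f u (polyGrad (fun i x => g i (x + a)) P u) = Torus.nsGeneratorPairing ν f u' (polyGrad g P u')) := by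
  intro N u a hu
  obtain ⟨u', hu', h⟩ := exists_isLevel_coef_eq_twist hu a
  exact ⟨u', hu', h, norm_eq_of_coef_twist hu hu' h, pairing_shifted hu hu' h,
    fun ν _ hf => nsGeneratorPairing_shifted hu hu' h ν hf,
    fun ν _ hf _ g P => nsGeneratorPairing_polyGrad_shifted hu hu' h ν hf g P⟩

end Summit.AnomalousDissipation.AnomalousDissipation.Theorems.MomentParityQuarticGate
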